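import Summits.BirchSwinnertonDyer.Rank1Residual.WAll.TargetCMTwoRamifiedBookedIsogeny
import Summits.BirchSwinnertonDyer.Rank1Residual.WAll.AltClosersCMTwoRamifiedFamilies
import Summits.BirchSwinnertonDyer.BirchSwinnertonDyer.Theorems.PrintCf2RamifiedOffTYZThetaLeaf
import Literature.NumberTheory.EllipticCurves.Wuthrich2014.ShaBoundProofs
import Literature.NumberTheory.EllipticCurves.ComplexMultiplicationLFunctionIsogenyHoldsProofs
import HarnessLib

/-!
# Route `PrintCf2`, crux stmt-BirchSwinnertonDyer-20509 `RamifiedOffTYZOfFacts` — ISOGENY SATURATION of the booked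
# congruent-number families: the leaf `WAllCornerFTwoRamifiedBookedIsogeny` CLOSED RELATIVE to the five model leaves
# (granted Cassels + GZK + modularity, conjuncts 1–3 of `𝔅_ram`), its flag-free in-bundle part CLOSED OUTRIGHT, and
# the registered residual stub RE-CUT to the isogeny-class residual (cell `bsd-print-cf2`, seat p1 = lead; skeleton v4)

HONEST FRAMING (cell `bsd-print-cf2`, run/shared/lean/pub/bsd-print-cf2/; route `PrintCf2`; crux 20509 =
`𝔅_ram → WAllCornerFTwoRamifiedOffTYZProved`, OPEN): nothing asserted, no named fact introduced, no route file
imported (bsd-wall T9: every statement is over Literature facts and W-ALL leaves, the bundle `𝔅_ram` displayed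
VERBATIM as in `Theses/PrintCf2.lean`). The W-ALL statement file `WAll/TargetCMTwoRamifiedBookedIsogeny.lean` (this
seat) names the `ℚ`-isogeny closure `CongruentBookedIsogenyClass` of the five booked congruent-number family
predicates (proved TYZ / U⁺ / FJ atlas / `𝒮⁻` / theta), the leaf `WAllCornerFTwoRamifiedBookedIsogeny` and the
residual `WAllCornerFTwoRamifiedOffBookedIsogeny` («CM, `r_an = 1`, `2 ∣ d_K`, isogenous to NO booked `E_n` and to
NO Shu–Zhai twist of `256c1` ⇒ `BSD(E,2)`»). This file proves:

* §1 `bsdp_two_of_isIsogenous_of_facts` — `BSD(·,2)` moves along a `ℚ`-isogeny of globally minimal curves of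
  analytic rank one, granted Cassels (`bsdRHS_eq_of_isIsogenous`), GZK (`Ш` finite) and modularity
  (`L′(E,1) ≠ 0`): the tree's `Wuthrich2014.bsdp_of_isIsogenous` with its side conditions discharged (the pattern
  of seat p4's `PrintCf2.bsdp_two_of_isIsogenous_tyzProved`, p545974, made family-agnostic).
* §2 `wAllCornerFTwoRamifiedBookedIsogeny_of_leaves` — the RELATIVE CLOSER: the five model leaves + the three
  facts ⟹ the booked-isogeny leaf (each class keeps the booking currency of its model leaf: flag-free for
  TYZProved / FJ atlas, LITERAL-by-name for U⁺ (`tyz_genusPointData`), `𝒮⁻` (`hTSYS`), theta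
  (`tyz_cmPointGaloisData` + TYZ Thm 1.1)); `bookedIsogeny_of_bundle_of_uPlus_of_theta` — the same from `𝔅_ram`
  (which CLOSES the TYZProved / FJ-atlas / `𝒮⁻` model leaves: p535702, p541735, p546023) plus the two LITERAL
  leaves as hypotheses.
* §3 `bsdp_two_of_isIsogenous_inBundle_of_bundle` — the FLAG-FREE-ROAD PART CLOSED OUTRIGHT inside `𝔅_ram`:
  every globally minimal CM curve of analytic rank one `ℚ`-isogenous to a member of `CongruentTYZProvedFamily`,
  `CongruentTYZAtlasFJFamily` or `CongruentMonskySMinusFamily` satisfies `BSD(E,2)` — in particular, granted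
  `𝔅_ram`, BOTH `j = 287496` partners `32a3^{(±n)}` and the `j = 1728` partner `y² = x³ + 4n²x` (`n` odd) /
  `y² = x³ + (n/2)²x` (`n` even) of every such `E_n` — a class statement printed nowhere (beyond-print as an
  ASSEMBLY: Cassels 1965 + the booked theorems; no new arithmetic).
* §4 the lead's bookkeeping for skeleton v4 of crux 20509: `stub_offTYZ_residual_of_uPlus_of_theta_of_shuZhai_of_off`
  (the registered v3 residual stub `𝔅_ram → WAllCornerFTwoRamifiedOffTYZOffSMinusOffTheta` follows from the U⁺,
  theta and Shu–Zhai stubs and the NEW residual stub `𝔅_ram → WAllCornerFTwoRamifiedOffBookedIsogeny`) and the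
  composition `offTYZProved_of_bundle_of_uPlus_of_theta_of_shuZhai_of_off` (crux conclusion from the bundle, the
  three beyond-bundle leaves — asides 20471, 21185, 21183 — and the isogeny-class residual, OPEN, no print).

beyond-print theorem: NO as a method (Cassels / Milne ADT I.7.3); YES as an assembly for §3.
[cite: MilneADT2006, Thm. I.7.3] [cite: Miller2011LMS, §1 and Def. 1.1 (arXiv:1010.2431 p. 3)]
[cite: Knapp1993, Thm. 11.67 (PDF p. 281)] [cite: CremonaAlgorithms1997, §3.8 and Table 1 (class 32a)]
-/

noncomputable section

open scoped Classical

open WeierstrassCurve Summit.BirchSwinnertonDyer Summit.BirchSwinnertonDyer.Rank1Residual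
  Literature.NumberTheory.EllipticCurves Literature.NumberTheory.EllipticCurves.Rank1Residual
  Literature.NumberTheory.EllipticCurves.TianYuanZhang2017

set_option autoImplicit false

namespace Summit.BirchSwinnertonDyer.PrintCf2

/-! ## §1 `BSD(·,2)` along a `ℚ`-isogeny in analytic rank one, granted Cassels + GZK + modularity -/

/-- **`BSD(E,2)` is constant on `ℚ`-isogeny classes of globally minimal curves of analytic rank one**, granted
Cassels' invariance of the BSD quotient (`hCAS`), Gross–Zagier–Kolyvagin (`hGZK`: `Ш(W₀)` finite) and modularity
(`hMOD`: `L′(W₀,1) ≠ 0` via `leadingLCoeff_ne_zero_holds`); the analytic rank moves by Faltings / Knapp 11.67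
(`analyticRank_eq_of_isIsogenous'`, proved). [cite: MilneADT2006, Thm. I.7.3] [cite: Knapp1993, Thm. 11.67 (PDF p. 281)] -/
theorem bsdp_two_of_isIsogenous_of_facts (hCAS : bsdRHS_eq_of_isIsogenous)
    (hGZK : rank_eq_analyticRank_of_analyticRank_le_one) (hMOD : hasEntireLFunction_rat)
    {W W₀ : WeierstrassCurve ℚ} [W.IsElliptic] [W.IsGloballyMinimal] [W₀.IsElliptic] [W₀.IsGloballyMinimal]
    (hiso : IsIsogenous W W₀) (hr : W.analyticRank = 1) (h₀ : BSDp W₀ 2) : BSDp W 2 := by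
  have hr₀ : W₀.analyticRank = 1 := by rw [← analyticRank_eq_of_isIsogenous' hiso]; exact hr
  exact Wuthrich2014.bsdp_of_isIsogenous hCAS hiso (hGZK W₀ hr₀.le).2
    (W₀.leadingLCoeff_ne_zero_holds (hMOD W₀)) h₀

/-! ## §2 The RELATIVE CLOSER of the booked-isogeny leaf -/

/-- **RELATIVE CLOSER of `WAllCornerFTwoRamifiedBookedIsogeny`**: the five model leaves (proved TYZ `hP`, U⁺ `hU`,
FJ atlas `hF`, `𝒮⁻` `hS`, theta `hT`) and Cassels + GZK + modularity give `BSD(W,2)` for every globally minimal `W`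
of analytic rank one `ℚ`-isogenous to a booked member `W₀` (`W₀` has CM with `2` ramified by membership, analytic
rank one by Faltings, hence `BSD(W₀,2)` by its leaf; transport by §1). The leaf's own hypotheses `HasCM`,
`CMRamified` on `W` are not used (they HOLD, `hasCM_and_cmRamified_two_of_congruentBookedIsogenyClass`).
[cite: MilneADT2006, Thm. I.7.3] [cite: Miller2011LMS, §1 and Def. 1.1 (arXiv:1010.2431 p. 3)] -/
theorem wAllCornerFTwoRamifiedBookedIsogeny_of_leaves (hCAS : bsdRHS_eq_of_isIsogenous)
    (hGZK : rank_eq_analyticRank_of_analyticRank_le_one) (hMOD : hasEntireLFunction_rat)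
    (hP : WAllCornerFTwoRamifiedTYZProved) (hU : WAllCornerFTwoRamifiedTYZUPlus)
    (hF : WAllCornerFTwoRamifiedTYZAtlasFJ) (hS : WAllCornerFTwoRamifiedSMinus)
    (hT : WAllCornerFTwoRamifiedTheta) : WAllCornerFTwoRamifiedBookedIsogeny := by
  intro W _ _ _ hr _ hI
  obtain ⟨W₀, _, _, hiso, hmem⟩ := hI
  obtain ⟨hCM₀, hram₀⟩ := hasCM_and_cmRamified_two_of_congruentBookedFamily hmem
  have hr₀ : W₀.analyticRank = 1 := by rw [← analyticRank_eq_of_isIsogenous' hiso]; exact hr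
  have h₀ : BSDp W₀ 2 := by
    rcases hmem with h | h | h | h | h
    · exact hP W₀ hCM₀ hr₀ hram₀ h
    · exact hU W₀ hCM₀ hr₀ hram₀ h
    · exact hF W₀ hCM₀ hr₀ hram₀ h
    · exact hS W₀ hCM₀ hr₀ hram₀ h
    · exact hT W₀ hCM₀ hr₀ hram₀ h
  exact bsdp_two_of_isIsogenous_of_facts hCAS hGZK hMOD hiso hr h₀

/-- **The booked-isogeny leaf from the bundle `𝔅_ram` and the two LITERAL leaves** (U⁺ `hU` — aside 20471;
theta `hT` — aside 21185): inside `𝔅_ram` the proved-TYZ leaf is p535702's closer (conjuncts 5–9 + 1), the FJ-atlas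
leaf is the landed stub `stub_offTYZ_atlasFJLeaf` (p541735) and the `𝒮⁻` leaf the landed stub
`stub_offTYZ_sMinusLeaf` (p546023); Cassels / GZK / modularity are conjuncts 3 / 1 / 2.
[cite: MilneADT2006, Thm. I.7.3] [cite: TianYuanZhang2017, Thm. 1.2 (as printed)] [cite: LiLiuTian2024, Thm. 1.2] -/
theorem bookedIsogeny_of_bundle_of_uPlus_of_theta
    (hB : (Literature.NumberTheory.EllipticCurves.rank_eq_analyticRank_of_analyticRank_le_one ∧ WeierstrassCurve.hasEntireLFunction_rat ∧ WeierstrassCurve.bsdRHS_eq_of_isIsogenous ∧ Literature.NumberTheory.EllipticCurves.bsdTriple_of_hasCM_of_L_one_ne_zero ∧ Literature.NumberTheory.EllipticCurves.TianYuanZhang2017.thm12_parity_of_scriptL' ∧ Literature.NumberTheory.EllipticCurves.Tian2014.thm13_rank_one_and_sha_odd ∧ Literature.NumberTheory.QuadraticFields.RedeiReichardt.redeiReichardt_fourTwoCard_classGroup ∧ Literature.NumberTheory.EllipticCurves.LiLiuTian2024.thm12_bsd_congruentNumberCurve ∧ Literature.NumberTheory.EllipticCurves.Monsky1990.cor515_rank_eq_one_and_card_selmerGroup_two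 ∧ Literature.NumberTheory.EllipticCurves.HeathBrown1994.monsky_card_selmerGroup_two_even ∧ Literature.NumberTheory.EllipticCurves.Tian2014.tian2014_system_sMinus_genus))
    (hU : WAllCornerFTwoRamifiedTYZUPlus) (hT : WAllCornerFTwoRamifiedTheta) :
    WAllCornerFTwoRamifiedBookedIsogeny := by
  obtain ⟨hGZK, hMOD, hCAS, -, h12, h13, hRR, hLLT, h515, -, -⟩ := id hB
  exact wAllCornerFTwoRamifiedBookedIsogeny_of_leaves hCAS hGZK hMOD
    (Rank1Residual.WAll.PrintCf2.wAllCornerFTwoRamifiedTYZProved_of_facts h12 h13 hRR hLLT h515 hGZK) hU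
    (stub_offTYZ_atlasFJLeaf hB) (stub_offTYZ_sMinusLeaf hB) hT

/-! ## §3 The flag-free-road part, CLOSED OUTRIGHT inside `𝔅_ram` -/

/-- **ISOGENY CLASSES OF THE IN-BUNDLE FAMILIES, CLOSED** (beyond print as an assembly): granted `𝔅_ram`, every
globally minimal CM curve `W` of analytic rank one with `2` ramified in `K` that is `ℚ`-isogenous to a globally
minimal member `W₀` of `CongruentTYZProvedFamily` (LLT / T5 / T7 / M35 / TYZρ), of `CongruentTYZAtlasFJFamily` or of
`CongruentMonskySMinusFamily` satisfies `BSD(W,2)` — e.g. both `j = 287496` twists `32a3^{(±n)}` and the quartic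
twist `y² = x³ + 4n²x` for every `n ≡ 5 (mod 8)` with all prime factors `≡ 1 (mod 4)` and no class of order `4`
in `Cl(ℚ(√−n))`. [cite: LiLiuTian2024, Thm. 1.2] [cite: TianYuanZhang2017, Thm. 1.2 (as printed)]
[cite: MilneADT2006, Thm. I.7.3] [cite: CremonaAlgorithms1997, §3.8 and Table 1 (class 32a)] -/
theorem bsdp_two_of_isIsogenous_inBundle_of_bundle
    (hB : (Literature.NumberTheory.EllipticCurves.rank_eq_analyticRank_of_analyticRank_le_one ∧ WeierstrassCurve.hasEntireLFunction_rat ∧ WeierstrassCurve.bsdRHS_eq_of_isIsogenous ∧ Literature.NumberTheory.EllipticCurves.bsdTriple_of_hasCM_of_L_one_ne_zero ∧ Literature.NumberTheory.EllipticCurves.TianYuanZhang2017.thm12_parity_of_scriptL' ∧ Literature.NumberTheory.EllipticCurves.Tian2014.thm13_rank_one_and_sha_odd ∧ Literature.NumberTheory.QuadraticFields.RedeiReichardt.redeiReichardt_fourTwoCard_classGroup ∧ Literature.NumberTheory.EllipticCurves.LiLiuTian2024.thm12_bsd_congruentNumberCurve ∧ Literature.NumberTheory.EllipticCurves.Monsky1990.cor515_rank_eq_one_and_card_selmerGroup_two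 ∧ Literature.NumberTheory.EllipticCurves.HeathBrown1994.monsky_card_selmerGroup_two_even ∧ Literature.NumberTheory.EllipticCurves.Tian2014.tian2014_system_sMinus_genus)) :
    ∀ (W : WeierstrassCurve ℚ) [W.IsElliptic] [W.IsGloballyMinimal],
      W.HasCM → W.analyticRank = 1 → CMRamified W 2 →
        (∃ (W₀ : WeierstrassCurve ℚ) (_ : W₀.IsElliptic) (_ : W₀.IsGloballyMinimal), IsIsogenous W W₀ ∧
          (CongruentTYZProvedFamily W₀ ∨ CongruentTYZAtlasFJFamily W₀ ∨ CongruentMonskySMinusFamily W₀)) →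
        BSDp W 2 := by
  obtain ⟨hGZK, hMOD, hCAS, -, h12, h13, hRR, hLLT, h515, -, -⟩ := id hB
  have hP := Rank1Residual.WAll.PrintCf2.wAllCornerFTwoRamifiedTYZProved_of_facts h12 h13 hRR hLLT h515 hGZK
  have hF := stub_offTYZ_atlasFJLeaf hB
  have hS := stub_offTYZ_sMinusLeaf hB
  intro W _ _ _ hr _ hI
  obtain ⟨W₀, _, _, hiso, hmem⟩ := hI
  have hr₀ : W₀.analyticRank = 1 := by rw [← analyticRank_eq_of_isIsogenous' hiso]; exact hr
  have h₀ : BSDp W₀ 2 := by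
    rcases hmem with h | h | h
    · obtain ⟨hCM₀, hram₀⟩ := hasCM_and_cmRamified_two_of_congruentTYZProvedFamily h
      exact hP W₀ hCM₀ hr₀ hram₀ h
    · obtain ⟨hCM₀, hram₀⟩ := hasCM_and_cmRamified_two_of_congruentTYZAtlasFJFamily h
      exact hF W₀ hCM₀ hr₀ hram₀ h
    · obtain ⟨hCM₀, hram₀⟩ := hasCM_and_cmRamified_two_of_congruentMonskySMinusFamily h
      exact hS W₀ hCM₀ hr₀ hram₀ h
  exact bsdp_two_of_isIsogenous_of_facts hCAS hGZK hMOD hiso hr h₀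

/-! ## §4 Skeleton v4 of crux 20509: the v3 residual stub re-cut, and the composition -/

/-- **The REGISTERED v3 residual stub `stub_offTYZ_residual` (𝔅_ram ⟹ six-way residual
`WAllCornerFTwoRamifiedOffTYZOffSMinusOffTheta`, skeleton 628fa099) is CUT THREE WAYS**: it follows from «𝔅_ram ⟹ U⁺
leaf» and «𝔅_ram ⟹ theta leaf» (open in-bundle; asides 20471 / 21185 closed beyond it), «𝔅_ram ⟹ Shu–Zhai `256c1`
leaf» (open in-bundle; aside 21183, seat p2) and «𝔅_ram ⟹ isogeny-class residual» (OPEN, no print) — the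
booked-isogeny leaf costing nothing beyond the bundle and the two LITERAL leaves. [folklore] -/
theorem stub_offTYZ_residual_of_uPlus_of_theta_of_shuZhai_of_off
    (hU : (Literature.NumberTheory.EllipticCurves.rank_eq_analyticRank_of_analyticRank_le_one ∧ WeierstrassCurve.hasEntireLFunction_rat ∧ WeierstrassCurve.bsdRHS_eq_of_isIsogenous ∧ Literature.NumberTheory.EllipticCurves.bsdTriple_of_hasCM_of_L_one_ne_zero ∧ Literature.NumberTheory.EllipticCurves.TianYuanZhang2017.thm12_parity_of_scriptL' ∧ Literature.NumberTheory.EllipticCurves.Tian2014.thm13_rank_one_and_sha_odd ∧ Literature.NumberTheory.QuadraticFields.RedeiReichardt.redeiReichardt_fourTwoCard_classGroup ∧ Literature.NumberTheory.EllipticCurves.LiLiuTian2024.thm12_bsd_congruentNumberCurve ∧ Literature.NumberTheory.EllipticCurves.Monsky1990.cor515_rank_eq_one_and_card_selmerGroup_two ∧ Literature.NumberTheory.EllipticCurves.HeathBrown1994.monsky_card_selmerGroup_two_even ∧ Literature.NumberTheory.EllipticCurves.Tian2014.tian2014_system_sMinus_genus) → Summit.BirchSwinnertonDyer.WAllCo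rnerFTwoRamifiedTYZUPlus)
    (hT : (Literature.NumberTheory.EllipticCurves.rank_eq_analyticRank_of_analyticRank_le_one ∧ WeierstrassCurve.hasEntireLFunction_rat ∧ WeierstrassCurve.bsdRHS_eq_of_isIsogenous ∧ Literature.NumberTheory.EllipticCurves.bsdTriple_of_hasCM_of_L_one_ne_zero ∧ Literature.NumberTheory.EllipticCurves.TianYuanZhang2017.thm12_parity_of_scriptL' ∧ Literature.NumberTheory.EllipticCurves.Tian2014.thm13_rank_one_and_sha_odd ∧ Literature.NumberTheory.QuadraticFields.RedeiReichardt.redeiReichardt_fourTwoCard_classGroup ∧ Literature.NumberTheory.EllipticCurves.LiLiuTian2024.thm12_bsd_congruentNumberCurve ∧ Literature.NumberTheory.EllipticCurves.Monsky1990.cor515_rank_eq_one_and_card_selmerGroup_two ∧ Literature.NumberTheory.EllipticCurves.HeathBrown1994.monsky_card_selmerGroup_two_even ∧ Literature.NumberTheory.EllipticCurves.Tian2014.tian2014_system_sMinus_genus) → Summit.BirchSwinnertonDyer.WAllCornerFTwoRamifiedTheta)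
    (hZ : (Literature.NumberTheory.EllipticCurves.rank_eq_analyticRank_of_analyticRank_le_one ∧ WeierstrassCurve.hasEntireLFunction_rat ∧ WeierstrassCurve.bsdRHS_eq_of_isIsogenous ∧ Literature.NumberTheory.EllipticCurves.bsdTriple_of_hasCM_of_L_one_ne_zero ∧ Literature.NumberTheory.EllipticCurves.TianYuanZhang2017.thm12_parity_of_scriptL' ∧ Literature.NumberTheory.EllipticCurves.Tian2014.thm13_rank_one_and_sha_odd ∧ Literature.NumberTheory.QuadraticFields.RedeiReichardt.redeiReichardt_fourTwoCard_classGroup ∧ Literature.NumberTheory.EllipticCurves.LiLiuTian2024.thm12_bsd_congruentNumberCurve ∧ Literature.NumberTheory.EllipticCurves.Monsky1990.cor515_rank_eq_one_and_card_selmerGroup_two ∧ Literature.NumberTheory.EllipticCurves.HeathBrown1994.monsky_card_selmerGroup_two_even ∧ Literature.NumberTheory.EllipticCurves.Tian2014.tian2014_system_sMinus_genus) → Summit.BirchSwinnertonDyer.WAllCornerFTwoRamifiedShuZhaiTwoFiftySix)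
    (hO : (Literature.NumberTheory.EllipticCurves.rank_eq_analyticRank_of_analyticRank_le_one ∧ WeierstrassCurve.hasEntireLFunction_rat ∧ WeierstrassCurve.bsdRHS_eq_of_isIsogenous ∧ Literature.NumberTheory.EllipticCurves.bsdTriple_of_hasCM_of_L_one_ne_zero ∧ Literature.NumberTheory.EllipticCurves.TianYuanZhang2017.thm12_parity_of_scriptL' ∧ Literature.NumberTheory.EllipticCurves.Tian2014.thm13_rank_one_and_sha_odd ∧ Literature.NumberTheory.QuadraticFields.RedeiReichardt.redeiReichardt_fourTwoCard_classGroup ∧ Literature.NumberTheory.EllipticCurves.LiLiuTian2024.thm12_bsd_congruentNumberCurve ∧ Literature.NumberTheory.EllipticCurves.Monsky1990.cor515_rank_eq_one_and_card_selmerGroup_two ∧ Literature.NumberTheory.EllipticCurves.HeathBrown1994.monsky_card_selmerGroup_two_even ∧ Literature.NumberTheory.EllipticCurves.Tian2014.tian2014_system_sMinus_genus) → Summit.BirchSwinnertonDyer.WAllCornerFTwoRamifiedOffBookedIsogeny) :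
    (Literature.NumberTheory.EllipticCurves.rank_eq_analyticRank_of_analyticRank_le_one ∧ WeierstrassCurve.hasEntireLFunction_rat ∧ WeierstrassCurve.bsdRHS_eq_of_isIsogenous ∧ Literature.NumberTheory.EllipticCurves.bsdTriple_of_hasCM_of_L_one_ne_zero ∧ Literature.NumberTheory.EllipticCurves.TianYuanZhang2017.thm12_parity_of_scriptL' ∧ Literature.NumberTheory.EllipticCurves.Tian2014.thm13_rank_one_and_sha_odd ∧ Literature.NumberTheory.QuadraticFields.RedeiReichardt.redeiReichardt_fourTwoCard_classGroup ∧ Literature.NumberTheory.EllipticCurves.LiLiuTian2024.thm12_bsd_congruentNumberCurve ∧ Literature.NumberTheory.EllipticCurves.Monsky1990.cor515_rank_eq_one_and_card_selmerGroup_two ∧ Literature.NumberTheory.EllipticCurves.HeathBrown1994.monsky_card_selmerGroup_two_even ∧ Literature.NumberTheory.EllipticCurves.Tian2014.tian2014_system_sMinus_genus) → Summit.BirchSwinnertonDyer.WAllCornerFTwoRamifiedOffTYZOffSMinusOffTheta :=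
  fun hB ↦ wAllCornerFTwoRamifiedOffTYZOffSMinusOffTheta_of_shuZhai_of_bookedIsogeny_of_off (hZ hB)
    (bookedIsogeny_of_bundle_of_uPlus_of_theta hB (hU hB) (hT hB)) (hO hB)

/-- **Crux 20509's conclusion from the bundle, the three beyond-bundle leaves and the isogeny-class residual** —
the composition `RamifiedOffTYZOfFacts_of` of skeleton v4: U⁺ leaf (`hU`, aside 20471), theta leaf (`hT`, aside 21185),
Shu–Zhai `256c1` leaf (`hZ`, aside 21183), isogeny-class residual (`hO`, OPEN, no print); the proved-TYZ / FJ-atlas /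
`𝒮⁻` leaves and the isogeny saturation come from `𝔅_ram` itself. [folklore] -/
theorem offTYZProved_of_bundle_of_uPlus_of_theta_of_shuZhai_of_off
    (hB : (Literature.NumberTheory.EllipticCurves.rank_eq_analyticRank_of_analyticRank_le_one ∧ WeierstrassCurve.hasEntireLFunction_rat ∧ WeierstrassCurve.bsdRHS_eq_of_isIsogenous ∧ Literature.NumberTheory.EllipticCurves.bsdTriple_of_hasCM_of_L_one_ne_zero ∧ Literature.NumberTheory.EllipticCurves.TianYuanZhang2017.thm12_parity_of_scriptL' ∧ Literature.NumberTheory.EllipticCurves.Tian2014.thm13_rank_one_and_sha_odd ∧ Literature.NumberTheory.QuadraticFields.RedeiReichardt.redeiReichardt_fourTwoCard_classGroup ∧ Literature.NumberTheory.EllipticCurves.LiLiuTian2024.thm12_bsd_congruentNumberCurve ∧ Literature.NumberTheory.EllipticCurves.Monsky1990.cor515_rank_eq_one_and_card_selmerGroup_two ∧ Literature.NumberTheory.EllipticCurves.HeathBrown1994.monsky_card_selmerGroup_two_even ∧ Literature.NumberTheory.EllipticCurves.Tian2014.tian2014_system_sMinus_genus))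
    (hU : WAllCornerFTwoRamifiedTYZUPlus) (hT : WAllCornerFTwoRamifiedTheta)
    (hZ : WAllCornerFTwoRamifiedShuZhaiTwoFiftySix) (hO : WAllCornerFTwoRamifiedOffBookedIsogeny) :
    WAllCornerFTwoRamifiedOffTYZProved :=
  wAllCornerFTwoRamifiedOffTYZProved_of_bookedIsogeny_of_shuZhai_of_off
    (bookedIsogeny_of_bundle_of_uPlus_of_theta hB hU hT) hZ hO

end Summit.BirchSwinnertonDyer.PrintCf2

end
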